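import Mathlib
import HarnessLib

/-!
# The wild analogue `(G₉)` at `3`: the arithmetic of the `2`-division cubic (integers only)

Route `CyclotomicUntwist` (sub-problem `BirchSwinnertonDyer`), crux `PSRankOneLowerHalfAtThree`
(item stmt-BirchSwinnertonDyer-21580), registered line `birth`, stub `stub_gNineCriterion`
(FIRST LEMMA `GNineCriterion`). Pure integer arithmetic of the cubic `x³ + A x² + B x + C`
(`disc = A²B² − 4B³ − 4A³C − 27C² + 18ABC`) at the prime `3`, Tate's algorithm at `p = 3` in
disguise, extracting from "`v₃(disc)` even with square unit part" (the principal-series rows of the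
wild cell, `Δ_min ∈ (ℚ₃^×)²`) the residue patterns consumed by the geometric kernels of
`CyclotomicUntwistGNineKernelNine.lean`:
* `exists_translate_three_dvd` — the cusp translation: `3 ∣ A`, `3 ∣ disc` ⟹ some integer
  translate has `3 ∣ A, B, C` (`disc` and `A² − 3B` are translation invariants);
* `twentyseven_dvd_disc` — then `27 ∣ disc` (so `v₃(disc) ≥ 3`);
* `pattern_four` — `disc = 81·d`, `d ≡ 1 (mod 3)` ⟹ `A ≡ 3ε, B ≡ 0, C ≡ −3ε (mod 9)`;
* `pattern_six` — `disc = 729·d`, `d ≡ 1 (mod 3)` ⟹ `9 ∣ B, 27 ∣ C` or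
  `9 ∣ A, B ≡ −9, C ≡ −9ε (mod 27)`;
* `pattern_high` — `3⁸ ∣ disc`, `27 ∣ A² − 3B` (potentially good) ⟹ `9 ∣ A, 27 ∣ B, 27 ∣ C`
  (the `ℚ(√−3)`-twist is then integral with `v₃(disc)` lowered by `6`);
* `disc_twist` — `disc(−3a, 3b, −c)·3⁶ = disc(9a, 27b, 27c)`.
The finite residue computations are discharged by `decide` over `ZMod 3`, `ZMod 9`, `ZMod 27`.

Theorems only; no definition, no named fact; nothing about BSD is asserted.
References: A. Kraus, Manuscripta Math. 69 (1990) 353–385 (types at `p = 3`); J. Tate, Antwerp IV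
(1975), algorithm steps 1–6; N. Coppola, Acta Arith. 195 (2020) Lemma 2.6, Thm. 2.7.
-/

set_option linter.dupNamespace false

namespace Summit.BirchSwinnertonDyer.BirchSwinnertonDyer.Theorems.GNineCriterion

/-! ### Casting divisibility to `ZMod n` and back -/

/-- `n ∣ x` gives `x = 0` in `ZMod n`. [folklore] -/
theorem zmod_eq_zero_of_dvd {n : ℕ} [NeZero n] {x : ℤ} (h : (n : ℤ) ∣ x) : (x : ZMod n) = 0 :=
  (ZMod.intCast_zmod_eq_zero_iff_dvd x n).mpr h

/-- `x = 0` in `ZMod n` gives `n ∣ x`. [folklore] -/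
theorem dvd_of_zmod_eq_zero {n : ℕ} [NeZero n] {x : ℤ} (h : (x : ZMod n) = 0) : (n : ℤ) ∣ x :=
  (ZMod.intCast_zmod_eq_zero_iff_dvd x n).mp h

/-- `x = 0` in `ZMod 3` gives `3 ∣ x` (literal form). [folklore] -/
theorem three_dvd_of_zmod {x : ℤ} (h : (x : ZMod 3) = 0) : (3 : ℤ) ∣ x := by
  exact_mod_cast dvd_of_zmod_eq_zero h

/-- `3 ∣ x` gives `x = 0` in `ZMod 3` (literal form). [folklore] -/
theorem zmod_three_of_dvd {x : ℤ} (h : (3 : ℤ) ∣ x) : (x : ZMod 3) = 0 :=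
  zmod_eq_zero_of_dvd (by exact_mod_cast h)

/-! ### Translation -/

/-- The discriminant of the cubic is invariant under `x ↦ x + t`. [folklore] -/
theorem disc_translate (A B C t : ℤ) :
    (A + 3 * t) ^ 2 * (B + 2 * t * A + 3 * t ^ 2) ^ 2 - 4 * (B + 2 * t * A + 3 * t ^ 2) ^ 3
      - 4 * (A + 3 * t) ^ 3 * (C + t * B + t ^ 2 * A + t ^ 3)
      - 27 * (C + t * B + t ^ 2 * A + t ^ 3) ^ 2
      + 18 * (A + 3 * t) * (B + 2 * t * A + 3 * t ^ 2) * (C + t * B + t ^ 2 * A + t ^ 3) =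
    A ^ 2 * B ^ 2 - 4 * B ^ 3 - 4 * A ^ 3 * C - 27 * C ^ 2 + 18 * A * B * C := by
  ring

/-- `A² − 3B` (`= c₄/16`) is invariant under `x ↦ x + t`. [folklore] -/
theorem csub_translate (A B t : ℤ) :
    (A + 3 * t) ^ 2 - 3 * (B + 2 * t * A + 3 * t ^ 2) = A ^ 2 - 3 * B := by
  ring

/-- **Cusp translation** (Tate's algorithm, step 2 at `p = 3`): if `3 ∣ A` and `3 ∣ disc` then
after a translation `x ↦ x + t` all of `A, B, C` are divisible by `3`. [cite: SilvermanAEC2009, VII.1] -/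
theorem exists_translate_three_dvd (A B C : ℤ) (hA : (3 : ℤ) ∣ A)
    (hD : (3 : ℤ) ∣ A ^ 2 * B ^ 2 - 4 * B ^ 3 - 4 * A ^ 3 * C - 27 * C ^ 2 + 18 * A * B * C) :
    ∃ t : ℤ, (3 : ℤ) ∣ A + 3 * t ∧ (3 : ℤ) ∣ B + 2 * t * A + 3 * t ^ 2 ∧
      (3 : ℤ) ∣ C + t * B + t ^ 2 * A + t ^ 3 := by
  have hA0 : ((A : ℤ) : ZMod 3) = 0 := zmod_three_of_dvd hA
  have hD0 := zmod_three_of_dvd hD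
  push_cast at hD0
  rw [hA0] at hD0
  have key : ∀ b c : ZMod 3, 0 ^ 2 * b ^ 2 - 4 * b ^ 3 - 4 * 0 ^ 3 * c - 27 * c ^ 2
      + 18 * 0 * b * c = 0 → b = 0 := by decide
  have hB0 : ((B : ℤ) : ZMod 3) = 0 := key _ _ hD0
  refine ⟨-C, ?_, ?_, ?_⟩
  · apply three_dvd_of_zmod
    push_cast; rw [hA0]
    have k : ∀ c : ZMod 3, 0 + 3 * -c = 0 := by decide
    exact k _
  · apply three_dvd_of_zmod
    push_cast; rw [hA0, hB0]
    have k : ∀ c : ZMod 3, 0 + 2 * -c * 0 + 3 * (-c) ^ 2 = 0 := by decide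
    exact k _
  · apply three_dvd_of_zmod
    push_cast; rw [hA0, hB0]
    have k : ∀ c : ZMod 3, c + -c * 0 + (-c) ^ 2 * 0 + (-c) ^ 3 = 0 := by decide
    exact k _

/-- With `3 ∣ A, B, C` the discriminant is `27·(3a²b² − 4b³ − 12a³c − 9c² + 18abc)`; in
particular `27 ∣ disc`, i.e. `v₃(disc) ≥ 3`. [folklore] -/
theorem disc_eq_of_three_dvd (a b c : ℤ) :
    (3 * a) ^ 2 * (3 * b) ^ 2 - 4 * (3 * b) ^ 3 - 4 * (3 * a) ^ 3 * (3 * c) - 27 * (3 * c) ^ 2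
      + 18 * (3 * a) * (3 * b) * (3 * c) =
    27 * (3 * a ^ 2 * b ^ 2 - 4 * b ^ 3 - 12 * a ^ 3 * c - 9 * c ^ 2 + 18 * a * b * c) := by
  ring

/-! ### The residue patterns -/

/-- `3 ∣ A, B, C` and `3⁴ ∣ disc` force `9 ∣ B` (the `−4(B/3)³` term is the only one of
`disc/27` not divisible by `3`). [folklore] -/
theorem three_dvd_b (a b c e : ℤ)
    (hD : 3 * a ^ 2 * b ^ 2 - 4 * b ^ 3 - 12 * a ^ 3 * c - 9 * c ^ 2 + 18 * a * b * c = 3 * e) :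
    (3 : ℤ) ∣ b := by
  have h3 : (((3 * a ^ 2 * b ^ 2 - 4 * b ^ 3 - 12 * a ^ 3 * c - 9 * c ^ 2 + 18 * a * b * c
      : ℤ)) : ZMod 3) = 0 := zmod_three_of_dvd ⟨e, hD⟩
  push_cast at h3
  have key : ∀ x y z : ZMod 3, 3 * x ^ 2 * y ^ 2 - 4 * y ^ 3 - 12 * x ^ 3 * z - 9 * z ^ 2
      + 18 * x * y * z = 0 → y = 0 := by decide
  exact three_dvd_of_zmod (key _ _ _ h3)

/-- `3 ∣ 4 x → 3 ∣ x` and friends: cancelling a unit mod `3`. [folklore] -/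
theorem three_dvd_of_dvd_four_mul {x : ℤ} (h : (3 : ℤ) ∣ 4 * x) : (3 : ℤ) ∣ x := by
  rcases Int.prime_three.dvd_or_dvd h with h | h
  · norm_num at h
  · exact h

/-- **Pattern `v₃(disc) = 4`** (Kodaira II rows): `3 ∣ A, B, C`, `disc = 81 d`, `d ≡ 1 (mod 3)`
⟹ `A = 3ε + 9α'`, `B = 9β'`, `C = −3ε + 9γ'` with `ε = ±1`. (The unit part of `disc/81` is
`−(A/3)(C/3) mod 3`; being a square means `≡ 1`.) [cite: Kraus1990, Théorème 1 (p = 3)] -/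
theorem pattern_four (A B C d : ℤ) (hA : (3 : ℤ) ∣ A) (hB : (3 : ℤ) ∣ B) (hC : (3 : ℤ) ∣ C)
    (hD : A ^ 2 * B ^ 2 - 4 * B ^ 3 - 4 * A ^ 3 * C - 27 * C ^ 2 + 18 * A * B * C = 81 * d)
    (hd : d % 3 = 1) :
    ∃ ε α' β' γ' : ℤ, (ε = 1 ∨ ε = -1) ∧ A = 3 * ε + 9 * α' ∧ B = 9 * β' ∧ C = -3 * ε + 9 * γ' := by
  obtain ⟨a, rfl⟩ := hA
  obtain ⟨b, rfl⟩ := hB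
  obtain ⟨c, rfl⟩ := hC
  rw [disc_eq_of_three_dvd] at hD
  have hinner : 3 * a ^ 2 * b ^ 2 - 4 * b ^ 3 - 12 * a ^ 3 * c - 9 * c ^ 2 + 18 * a * b * c =
      3 * d := by linarith
  obtain ⟨b₁, rfl⟩ := three_dvd_b a b c d hinner
  have hk : d = 3 * (d / 3) + 1 := by omega
  -- `inner(a, 3b₁, c) = 9(3a²b₁² − 12b₁³ + 6ab₁c) − 12a³c − 9c² = 3d = 9(d/3) + 3`
  have h3 : (((4 * a ^ 3 * c + 1 : ℤ)) : ZMod 3) = 0 :=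
    zmod_three_of_dvd ⟨3 * a ^ 2 * b₁ ^ 2 - 12 * b₁ ^ 3 + 6 * a * b₁ * c - c ^ 2 - d / 3,
      by linarith⟩
  push_cast at h3
  have key : ∀ x z : ZMod 3, 4 * x ^ 3 * z + 1 = 0 →
      (x - 1 = 0 ∧ z + 1 = 0) ∨ (x + 1 = 0 ∧ z - 1 = 0) := by decide
  rcases key _ _ h3 with ⟨hx, hz⟩ | ⟨hx, hz⟩
  · have ha : (3 : ℤ) ∣ a - 1 := by
      apply three_dvd_of_zmod
      push_cast; exact hx
    have hc : (3 : ℤ) ∣ c + 1 := by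
      apply three_dvd_of_zmod
      push_cast; exact hz
    obtain ⟨α', hα'⟩ := ha
    obtain ⟨γ', hγ'⟩ := hc
    exact ⟨1, α', b₁, γ', Or.inl rfl, by linarith, by ring, by linarith⟩
  · have ha : (3 : ℤ) ∣ a + 1 := by
      apply three_dvd_of_zmod
      push_cast; exact hx
    have hc : (3 : ℤ) ∣ c - 1 := by
      apply three_dvd_of_zmod
      push_cast; exact hz
    obtain ⟨α', hα'⟩ := ha
    obtain ⟨γ', hγ'⟩ := hc
    exact ⟨-1, α', b₁, γ', Or.inr rfl, by linarith, by ring, by linarith⟩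

/-- **Pattern `v₃(disc) = 6`**: `3 ∣ A, B, C`, `disc = 729 d`, `d ≡ 1 (mod 3)` ⟹ either
`9 ∣ B ∧ 27 ∣ C` (Kodaira I₀*-shaped: witness `r = 0`) or `9 ∣ A`, `B ≡ −9 (mod 27)`,
`C ≡ −9ε (mod 27)` with `ε = ±1` (Kodaira IV rows: the unit part of `disc/3⁶` is `−B/9 mod 3`).
[cite: Kraus1990, Théorème 1 (p = 3)] -/
theorem pattern_six (A B C d : ℤ) (hA : (3 : ℤ) ∣ A) (hB : (3 : ℤ) ∣ B) (hC : (3 : ℤ) ∣ C)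
    (hD : A ^ 2 * B ^ 2 - 4 * B ^ 3 - 4 * A ^ 3 * C - 27 * C ^ 2 + 18 * A * B * C = 729 * d)
    (hd : d % 3 = 1) :
    (∃ a b c : ℤ, A = 3 * a ∧ B = 9 * b ∧ C = 27 * c) ∨
    (∃ ε α₁ β₂ γ₂ : ℤ, (ε = 1 ∨ ε = -1) ∧ A = 9 * α₁ ∧ B = -9 + 27 * β₂ ∧ C = -9 * ε + 27 * γ₂) := by
  obtain ⟨a, rfl⟩ := hA
  obtain ⟨b, rfl⟩ := hB
  obtain ⟨c, rfl⟩ := hC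
  rw [disc_eq_of_three_dvd] at hD
  have hinner : 3 * a ^ 2 * b ^ 2 - 4 * b ^ 3 - 12 * a ^ 3 * c - 9 * c ^ 2 + 18 * a * b * c =
      27 * d := by linarith
  obtain ⟨b₁, rfl⟩ := three_dvd_b a b c (9 * d) (by linarith)
  -- `inner(a, 3b₁, c) = 9(3a²b₁² − 12b₁³ + 6ab₁c) − 12a³c − 9c² = 27 d` ⟹ `3 ∣ 4a³c`
  have hac : (3 : ℤ) ∣ a ^ 3 * c := by
    apply three_dvd_of_dvd_four_mul
    exact ⟨3 * a ^ 2 * b₁ ^ 2 - 12 * b₁ ^ 3 + 6 * a * b₁ * c - 3 * d - c ^ 2, by linarith⟩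
  rcases Int.prime_three.dvd_or_dvd hac with ha3 | hc3
  · -- case `3 ∣ a`
    obtain ⟨a₂, rfl⟩ := Int.prime_three.dvd_of_dvd_pow ha3
    -- `inner(3a₂, 3b₁, c) = 27(9a₂²b₁² − 4b₁³ − 12a₂³c + 6a₂b₁c) − 9c² = 27d` ⟹ `3 ∣ c`
    have hc : (3 : ℤ) ∣ c := by
      have h : (3 : ℤ) ∣ c ^ 2 :=
        ⟨9 * a₂ ^ 2 * b₁ ^ 2 - 4 * b₁ ^ 3 - 12 * a₂ ^ 3 * c + 6 * a₂ * b₁ * c - d, by linarith⟩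
      exact Int.prime_three.dvd_of_dvd_pow h
    obtain ⟨c₁, rfl⟩ := hc
    -- `d = 9a₂²b₁² − 4b₁³ − 36a₂³c₁ + 18a₂b₁c₁ − 3c₁²` ⟹ `b₁ ≡ −1 (mod 3)`
    have hdq : d = 9 * a₂ ^ 2 * b₁ ^ 2 - 4 * b₁ ^ 3 - 36 * a₂ ^ 3 * c₁ + 18 * a₂ * b₁ * c₁
        - 3 * c₁ ^ 2 := by linarith
    have hk : d = 3 * (d / 3) + 1 := by omega
    have h3 : (((9 * a₂ ^ 2 * b₁ ^ 2 - 4 * b₁ ^ 3 - 36 * a₂ ^ 3 * c₁ + 18 * a₂ * b₁ * c₁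
        - 3 * c₁ ^ 2 - 1 : ℤ)) : ZMod 3) = 0 := zmod_three_of_dvd ⟨d / 3, by linarith⟩
    push_cast at h3
    have key : ∀ x y z : ZMod 3, 9 * x ^ 2 * y ^ 2 - 4 * y ^ 3 - 36 * x ^ 3 * z + 18 * x * y * z
        - 3 * z ^ 2 - 1 = 0 → y + 1 = 0 := by decide
    have hb : (3 : ℤ) ∣ b₁ + 1 := by
      apply three_dvd_of_zmod
      push_cast; exact key _ _ _ h3
    obtain ⟨β₂, hβ₂⟩ := hb
    -- split on `c₁ mod 3`
    have hc₁ : c₁ % 3 = 0 ∨ c₁ % 3 = 1 ∨ c₁ % 3 = 2 := by omega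
    rcases hc₁ with h0 | h1 | h2
    · left
      exact ⟨3 * a₂, b₁, c₁ / 3, by ring, by ring, by omega⟩
    · right
      exact ⟨-1, a₂, β₂, c₁ / 3, Or.inr rfl, by ring, by linarith, by omega⟩
    · right
      exact ⟨1, a₂, β₂, c₁ / 3 + 1, Or.inl rfl, by ring, by linarith, by omega⟩
  · -- case `3 ∤ a` would not be needed: `3 ∣ c` already gives the first alternative
    obtain ⟨c₁, rfl⟩ := hc3
    -- `inner(a, 3b₁, 3c₁) = 9(3a²b₁² − 12b₁³ − 4a³c₁ − 9c₁² + 18ab₁c₁) = 27d` ⟹ `3 ∣ 4a³c₁`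
    have hac' : (3 : ℤ) ∣ a ^ 3 * c₁ := by
      apply three_dvd_of_dvd_four_mul
      exact ⟨a ^ 2 * b₁ ^ 2 - 4 * b₁ ^ 3 - 3 * c₁ ^ 2 + 6 * a * b₁ * c₁ - d, by linarith⟩
    rcases Int.prime_three.dvd_or_dvd hac' with ha3 | hc3'
    · -- then also `3 ∣ a`: reduce to the previous shape directly
      obtain ⟨a₂, rfl⟩ := Int.prime_three.dvd_of_dvd_pow ha3
      have hdq : d = 9 * a₂ ^ 2 * b₁ ^ 2 - 4 * b₁ ^ 3 - 36 * a₂ ^ 3 * c₁ + 18 * a₂ * b₁ * c₁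
          - 3 * c₁ ^ 2 := by linarith
      have hk : d = 3 * (d / 3) + 1 := by omega
      have h3 : (((9 * a₂ ^ 2 * b₁ ^ 2 - 4 * b₁ ^ 3 - 36 * a₂ ^ 3 * c₁ + 18 * a₂ * b₁ * c₁
          - 3 * c₁ ^ 2 - 1 : ℤ)) : ZMod 3) = 0 := zmod_three_of_dvd ⟨d / 3, by linarith⟩
      push_cast at h3
      have key : ∀ x y z : ZMod 3, 9 * x ^ 2 * y ^ 2 - 4 * y ^ 3 - 36 * x ^ 3 * z
          + 18 * x * y * z - 3 * z ^ 2 - 1 = 0 → y + 1 = 0 := by decide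
      have hb : (3 : ℤ) ∣ b₁ + 1 := by
        apply three_dvd_of_zmod
        push_cast; exact key _ _ _ h3
      obtain ⟨β₂, hβ₂⟩ := hb
      have hc₁ : c₁ % 3 = 0 ∨ c₁ % 3 = 1 ∨ c₁ % 3 = 2 := by omega
      rcases hc₁ with h0 | h1 | h2
      · left
        exact ⟨3 * a₂, b₁, c₁ / 3, by ring, by ring, by omega⟩
      · right
        exact ⟨-1, a₂, β₂, c₁ / 3, Or.inr rfl, by ring, by linarith, by omega⟩
      · right
        exact ⟨1, a₂, β₂, c₁ / 3 + 1, Or.inl rfl, by ring, by linarith, by omega⟩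
    · left
      obtain ⟨c₂, rfl⟩ := hc3'
      exact ⟨a, b₁, c₂, by ring, by ring, by ring⟩

/-- **Pattern `v₃(disc) ≥ 8`** (Kodaira IV*, II* rows): `3 ∣ A, B, C`, `3⁸ ∣ disc` and
`27 ∣ A² − 3B` (potentially good reduction: `3·ord₃ c₄ ≥ ord₃ Δ`) ⟹ `9 ∣ A`, `27 ∣ B`, `27 ∣ C`
— so that the `ℚ(√−3)`-twist `(−A/3, B/9, −C/27)` is integral. [cite: Kraus1990, Théorème 1 (p = 3)] -/
theorem pattern_high (A B C : ℤ) (hA : (3 : ℤ) ∣ A) (hB : (3 : ℤ) ∣ B) (hC : (3 : ℤ) ∣ C)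
    (hD : (3 : ℤ) ^ 8 ∣ A ^ 2 * B ^ 2 - 4 * B ^ 3 - 4 * A ^ 3 * C - 27 * C ^ 2 + 18 * A * B * C)
    (hc4 : (27 : ℤ) ∣ A ^ 2 - 3 * B) :
    ∃ a b c : ℤ, A = 9 * a ∧ B = 27 * b ∧ C = 27 * c := by
  obtain ⟨a, rfl⟩ := hA
  obtain ⟨b, rfl⟩ := hB
  obtain ⟨c, rfl⟩ := hC
  rw [disc_eq_of_three_dvd] at hD
  obtain ⟨e, he⟩ := hD
  -- `3 ∣ b`
  obtain ⟨b₁, rfl⟩ := three_dvd_b a b c (3 ^ 4 * e) (by linarith)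
  -- `3 ∣ a` from `27 ∣ 9a² − 27b₁`
  have ha3 : (3 : ℤ) ∣ a := by
    obtain ⟨q, hq⟩ := hc4
    have h' : (3 : ℤ) ∣ a ^ 2 := ⟨q + b₁, by linarith⟩
    exact Int.prime_three.dvd_of_dvd_pow h'
  obtain ⟨a₁, rfl⟩ := ha3
  -- `3 ∣ c`: `inner(3a₁, 3b₁, c) = 27(…) − 9c²` and `27 ∣ inner`
  have hc3 : (3 : ℤ) ∣ c := by
    have h' : (3 : ℤ) ∣ c ^ 2 :=
      ⟨9 * a₁ ^ 2 * b₁ ^ 2 - 4 * b₁ ^ 3 - 12 * a₁ ^ 3 * c + 6 * a₁ * b₁ * c - 3 ^ 2 * e,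
        by linarith⟩
    exact Int.prime_three.dvd_of_dvd_pow h'
  obtain ⟨c₁, rfl⟩ := hc3
  -- `3 ∣ b₁`: `inner(3a₁, 3b₁, 3c₁) = 81(…) − 108 b₁³` and `81 ∣ inner`
  have hb3 : (3 : ℤ) ∣ b₁ := by
    have h' : (3 : ℤ) ∣ 4 * b₁ ^ 3 :=
      ⟨3 * a₁ ^ 2 * b₁ ^ 2 - 12 * a₁ ^ 3 * c₁ - c₁ ^ 2 + 6 * a₁ * b₁ * c₁ - 3 * e, by linarith⟩
    exact Int.prime_three.dvd_of_dvd_pow (three_dvd_of_dvd_four_mul h')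
  obtain ⟨b₂, rfl⟩ := hb3
  -- `3 ∣ c₁`: `inner(3a₁, 9b₂, 3c₁) = 243(…) − 81 c₁²` and `243 ∣ inner`
  have hc3' : (3 : ℤ) ∣ c₁ := by
    have h' : (3 : ℤ) ∣ c₁ ^ 2 :=
      ⟨9 * a₁ ^ 2 * b₂ ^ 2 - 12 * b₂ ^ 3 - 4 * a₁ ^ 3 * c₁ + 6 * a₁ * b₂ * c₁ - e, by linarith⟩
    exact Int.prime_three.dvd_of_dvd_pow h'
  obtain ⟨c₂, rfl⟩ := hc3'
  exact ⟨a₁, b₂, c₂, by ring, by ring, by ring⟩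

/-- The `ℚ(√−3)`-twist rescaled: `disc(−3a, 3b, −c)·3⁶ = disc(9a, 27b, 27c)` (weighted
homogeneity of the discriminant). [folklore] -/
theorem disc_twist (a b c : ℤ) :
    ((-(3 * a)) ^ 2 * (3 * b) ^ 2 - 4 * (3 * b) ^ 3 - 4 * (-(3 * a)) ^ 3 * (-c) - 27 * (-c) ^ 2
      + 18 * (-(3 * a)) * (3 * b) * (-c)) * 3 ^ 6 =
    (9 * a) ^ 2 * (27 * b) ^ 2 - 4 * (27 * b) ^ 3 - 4 * (9 * a) ^ 3 * (27 * c) - 27 * (27 * c) ^ 2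
      + 18 * (9 * a) * (27 * b) * (27 * c) := by
  ring

end Summit.BirchSwinnertonDyer.BirchSwinnertonDyer.Theorems.GNineCriterion
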